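import Summits.QuantumFields.YangMills.Theorems.BalabanUVNodesN08AlphaClassIDischarge
import Literature.MathematicalPhysics.QuantumFieldTheory.Balaban1983to89.B10Eq44LoopLocal

/-!
# Route «BalabanUVNodes», Track-A DAG node N08 = [Balaban1985UV3] Thm 1 p. 257 ∕ Thm 2 p. 272 — THE (α) CLAUSE OF THE d = 3 LANE,
# CLASS-I ROW `h44`: (44)'s LOOP-VARIABLE INPUT DERIVED FROM THE IN-EDGE FACE [7] (2)∕(8) for the CONCRETE loop variables
# `B_k(c) = (1∕i) log Ū^j(Γ_{y,c₋} ∪ c ∪ Γ_{c₊,y})` of the lifted composite minimizer (located item L1 of seat n08-d gen 0)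

Cell `pub-ymgap`, seat `pub-ymgap-dag-n08-d` gen 2 (director-ym R134 row n08-d s1 «… discharge the species-OK interfaces h68 ∕ hU ∕ h44 ∕
hLF67»; HUMAN RULING D-0062; chair R424 venue).  `bears_on: R4∕N08`; filed `--supports stmt-QuantumFields-19674`.  Sorry-free, standard
axioms; the definitions are lattice bookkeeping with bodies (integer representatives of torus sites, a coordinate box, a size function).

WHAT GEN 0 LEFT (its HANDOFF, located item L1).  `BalabanUVNodesN08AlphaClassI(Discharge)` splits the lane's (α) clause `RunAlpha` into the
cluster-expansion DATA (`RunDataRows`) and four in-edge FACES (`InEdgeFaces`: `measUk`, `loop28`, `inB42`, `reg2`); of these, `loop28` — (44)'s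
input «|B_k(c_i)| ≤ (L^jη)^{−1}|c_{i,−} − y|·8L²B₃g p(g)(L^jη)²» (p. 267 L3–5) — is a hypothesis on FREE sizes `OldTermSizes.loop`: (43)'s loop
variables had no body on the lane's carriers, and the tree's ladder `B10Eq44AvgRegularity.loop44_le` assumes the regularity of `U_k` on ALL of
`ηℤ³` (print: «on Ω_k», p. 267 L1) in `ℓ¹` coordinates of `ℤ³` (the lane: torus distances `Site.tdist`).  THIS FILE gives the loop variables
their body and DERIVES `loop28` from the face `reg2`, so that the (α) clause follows from the DATA, the (43)-form at the concrete sizes and the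
THREE faces `measUk ∕ inB42 ∕ reg2` (`runAlpha_of_data_faces₃`):
* §1 THE NEAREST-REPRESENTATIVE LIFT `T^{(j)} → ℤ³`: `repZ y` (integer labels), `nearRepZ y x` (the representative of `x` nearest to `repZ y`
  coordinatewise), `projJ`; `projJ_repZ`, `projJ_nearRepZ` (they represent `y`, `x`) and `l1_nearRepZ_sub_repZ`: the `ℓ¹` length of the lifted
  contour `Γ_{y,x}` IS the torus distance `Site.tdist x y` — gen 0's «nearest-representative lift with l1 = tdist».
* §2 THE CONCRETE SIZES: `loopOf 𝔊 𝔠 X k h U j y c = |B_{k+1}(c)| = ‖B10Eq27AxialLog.B27 (Ū^j of liftCfg 𝔊 (U_{k+1}(h, U))) (repZ y) (nearRepZ y c₋)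
  c.dir‖` on print's LOCALIZED index set `LocIn` and `0` elsewhere; `sizesOf 𝔊 𝔠 X coef : OldTermSizes S G` (coefficient sizes `|𝒫_j(Y_j)|` FREE —
  the cluster expansion's output, class II; loop sizes CONCRETE).  `LocIn k h j y c` («Y_j ⊂ Ω_k»): the history is admissible, `|c₋ − y| <
  R(g_j)M₁L^jη` (`Site.tdist c₋ y < Rcol j`, (43)), and every fine site under the scale-`j` box spanned by `y`, `c₋`, `c₊` lies in `Ω_k(h)` — the
  region the loop variable depends on ([4] p. 24 + (27)) is inside the small-field region, as for every term print keeps («localizations Y_j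
  not contained in Ω_{k+1}» are estimated and dropped at each step, p. 272 L29–31); `locIn_triv_iff` (non-vacuity at the trivial history).
* §3 `loop28_of_reg2`: gen 0's face `loop28` HOLDS for `sizesOf 𝔊 𝔠 X coef`, from `reg2` at level `k+1`, scale `k` (constant `C68·g_kp(g_k)·L^{−2k}`
  on `Ω_k(h)` — print's «|U_k(∂p) − 1| < 2L²B₃g_{k−1}p(g_{k−1})η² on Ω_k», p. 267 L1–2), by the LOCAL ladder `B10Eq44LoopLocal.loop44_le_local_unitaryGroup`
  ([4] Prop. 2 + (28), regularity only on the fine box under the contour's box), under the DISPLAYED smallness `LoopSmall` («for g_{k−1}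
  sufficiently small», p. 267 L7–8) and the constants relation `C68 ≤ 2L²B₃` ((68)'s O(1) against p. 267's `2L²B₃`).
* §4–§5 `InEdgeFaces₃` (= gen 0's `InEdgeFaces` without `loop28`), `inEdgeFaces_of_three`, `runAlpha_of_data_faces₃`, and N08 BY NAME at the
  C-binding of record over the constructed family from «DATA ∧ three faces» (`b10_main_constructedLE_upC_of_faces₃`, through gen 0's §5).
HONEST FRAMING: count-neutral kernel bookkeeping; NOT a discharge of N08.  Displayed after this file: the cluster-expansion DATA (classes II +
III); the (43)-form `OldTermForm` AT THE CONCRETE SIZES — its clause `mult43` now reads «the old terms are bounded multilinearly by the loop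
variables (27) of the averaged lifted minimizer on the localized admissible index set AND VANISH off it» (terms exist only for localizations
inside `Ω_k`; inadmissible histories have mass `0`, `Carriers.Regions`), STRONGER than gen 0's `mult43` at free sizes exactly by this
localization; the three faces about the FREE object `X.UkH`; `LoopSmall`; `C68 ≤ 2L²B₃`.  The pin of `X.UkH` to [7]'s minimizer is NODE 00's act;
nothing of [B10] is asserted; d = 3 lattice gauge theory on finite tori as printed; nothing about d = 4, the continuum, OS axioms, a mass gap
or the Clay problem.
-/

noncomputable section

namespace Summit.QuantumFields.YangMills.Theorems.BalabanUVNodesN08AlphaLoop28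

open scoped BigOperators Matrix.Norms.L2Operator
open Literature.MathematicalPhysics.QuantumFieldTheory.Balaban1983to89
open Literature.MathematicalPhysics.QuantumFieldTheory.Balaban1983to89.B10
open Literature.MathematicalPhysics.QuantumFieldTheory.Balaban1983to89.B10SectCExpansion (TermSizes)
open Literature.MathematicalPhysics.QuantumFieldTheory.Balaban1985CMP102
open Literature.MathematicalPhysics.QuantumFieldTheory.Balaban1985CMP102.Setting
open Literature.MathematicalPhysics.QuantumFieldTheory.Balaban1983to89.DagBinding (leavesP WorldP PrintedCarriersR PrintedCarriers9X
  PrintedCarriers11 PrintedCarriers14R PrintedCarriers15)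
open Literature.MathematicalPhysics.QuantumFieldTheory.Balaban1983to89.B10CompactBinding (ofPrintedAllXPNC)
open Summit.QuantumFields.Balaban3D.Carriers
open Summit.QuantumFields.Balaban3D.Proofs.Inputs
open Summit.QuantumFields.Balaban3D.Proofs.Primitives (AlphaConsts)
open Summit.QuantumFields.Balaban3D.Proofs.GroupModelLieC (lieC)
open Summit.QuantumFields.Balaban3D.Proofs.UVStability3DInputs
open Summit.QuantumFields.Balaban3D.Proofs.FamilyLE (ScalesLE)
open Summit.QuantumFields.Balaban3D.Proofs.ScalesArithmetic (gk_pos gk_le_one)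
open Summit.QuantumFields.Balaban3D.Proofs.CouplingWindow (pFun_pos)
open Summit.QuantumFields.Balaban3D.Proofs.LiftBridge (liftCfg liftCfg_mem_unitaryUnits)
open Summit.QuantumFields.Balaban3D.Proofs.TorusLift (projSite)
open Summit.QuantumFields.YangMills.Theorems.BalabanUVNodesN08AlphaClassI
open Summit.QuantumFields.YangMills.Theorems.BalabanUVNodesN08AlphaClassIDischarge (runAlpha_of_data_faces b10_main_constructedLE_upC_of_faces)
open B7Prop1Explicit (hol plaqWord e l1)
open B7Prop1Local (InBox loK add_e_apply)
open B7Prop2Explicit (avgIter unitaryUnits C0 c2' hol_plaqWord_self)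
open B10Eq27AxialLog (B27)
open B10Eq44LoopLocal (loop44_le_local_unitaryGroup)

variable {L : ℕ}

/-! ## §1 The nearest-representative lift of torus sites to `ℤ^d` -/

section Reps

variable {P : Params} {j : ℕ}

/-- The integer labels of a torus site of `T^{(j)}` (in `[0, sitesPerDir j)`), as a site of `ℤ^d`. [folklore] -/
def repZ (y : Site P j) : B7Prop1Explicit.Site P.d := fun κ => (((y κ).val : ℕ) : ℤ)

/-- The SIGNED NEAREST DIFFERENCE of two residues: `a − b` read in `(−n∕2, n∕2]`, i.e. `+(a − b).val` if that is the shorter way round the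
circle, else `−(b − a).val`. [folklore] -/
def sdiff {n : ℕ} [NeZero n] (a b : ZMod n) : ℤ :=
  if (a - b).val ≤ (b - a).val then ((a - b).val : ℤ) else -((b - a).val : ℤ)

/-- `|sdiff a b| = min((a − b).val, (b − a).val)` — the circle distance. [folklore] -/
theorem natAbs_sdiff {n : ℕ} [NeZero n] (a b : ZMod n) : (sdiff a b).natAbs = min (a - b).val (b - a).val := by
  unfold sdiff; split_ifs with h
  · rw [Int.natAbs_natCast, min_eq_left h]
  · rw [Int.natAbs_neg, Int.natAbs_natCast, min_eq_right (le_of_not_ge h)]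

/-- `sdiff a b ≡ a − b (mod n)`. [folklore] -/
theorem intCast_sdiff {n : ℕ} [NeZero n] (a b : ZMod n) : ((sdiff a b : ℤ) : ZMod n) = a - b := by
  unfold sdiff; split_ifs
  · rw [Int.cast_natCast, ZMod.natCast_zmod_val]
  · rw [Int.cast_neg, Int.cast_natCast, ZMod.natCast_zmod_val, neg_sub]

/-- THE REPRESENTATIVE OF `x` NEAREST TO `repZ y`: coordinatewise `repZ y + sdiff x y` (the lift of the torus contour `Γ_{y,x}` of (27)
to `ℤ^d` starts at `repZ y` and ends here). [cite: Balaban1985UV3, (27) p.263] -/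
def nearRepZ (y x : Site P j) : B7Prop1Explicit.Site P.d := fun κ => repZ y κ + sdiff (x κ) (y κ)

/-- The projection `ℤ^d → T^{(j)}` (labels mod the period; at `j = 0` this is `TorusLift.projSite`, definitionally). [folklore] -/
def projJ (j : ℕ) (w : B7Prop1Explicit.Site P.d) : Site P j := fun κ => ((w κ : ℤ) : ZMod (P.sitesPerDir j))

/-- `repZ y` represents `y`. [folklore] -/
theorem projJ_repZ (y : Site P j) : projJ j (repZ y) = y := by
  funext κ
  simp only [projJ, repZ, Int.cast_natCast, ZMod.natCast_zmod_val]

/-- `nearRepZ y x` represents `x`. [folklore] -/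
theorem projJ_nearRepZ (y x : Site P j) : projJ j (nearRepZ y x) = x := by
  funext κ
  simp only [projJ, nearRepZ, repZ, Int.cast_add, Int.cast_natCast, ZMod.natCast_zmod_val, intCast_sdiff, add_sub_cancel]

/-- **`l1 = tdist` FOR THE NEAREST-REPRESENTATIVE LIFT**: the `ℓ¹` length `|c₋ − y|₁` of the lifted contour (b07's `B7Prop1Explicit.l1`, the length
of `Γ_{y,c₋}` in the ladder (28)) is the scale-`j` torus distance `Site.tdist c₋ y` of the lane's old-term geometry `Carriers.oldGeom`
(whose `ℓ_j⁻¹·dist` is `tdist`, `Carriers.ell_inv_mul_dist`). [cite: Balaban1985UV3, (43)–(44) pp.266–267] -/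
theorem l1_nearRepZ_sub_repZ (y x : Site P j) : l1 (nearRepZ y x - repZ y) = Site.tdist x y := by
  unfold l1 Site.tdist
  refine Finset.sum_congr rfl fun κ _ => ?_
  have : (nearRepZ y x - repZ y) κ = sdiff (x κ) (y κ) := by
    simp only [Pi.sub_apply, nearRepZ, add_sub_cancel_left]
  rw [this, natAbs_sdiff]

end Reps

/-! ## §2 The scale-`j` box of a contour, print's localized index set, the concrete loop sizes -/

section Box

variable {d : ℕ}

/-- Lower corner `y ⊓ x` of the coordinate box spanned by the contour `Γ_{y,x} ∪ c ∪ Γ_{x+e_μ,y}`. [folklore] -/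
def boxLo (y x : B7Prop1Explicit.Site d) : B7Prop1Explicit.Site d := fun i => min (y i) (x i)

/-- Upper corner `y ⊔ (x + e_μ)` of that box. [folklore] -/
def boxHi (y x : B7Prop1Explicit.Site d) (μ : Fin d) : B7Prop1Explicit.Site d := fun i => max (y i) ((x + e μ) i)

/-- `x ≤ x + e_μ` coordinatewise. [folklore] -/
private theorem le_add_e (x : B7Prop1Explicit.Site d) (μ i : Fin d) : x i ≤ (x + e μ) i := by
  rw [add_e_apply]; split_ifs <;> omega

/-- `y`, `c₋ = x` and `c₊ = x + e_μ` lie in the box. [folklore] -/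
theorem inBox_box (y x : B7Prop1Explicit.Site d) (μ : Fin d) :
    InBox (boxLo y x) (boxHi y x μ) y ∧ InBox (boxLo y x) (boxHi y x μ) x ∧ InBox (boxLo y x) (boxHi y x μ) (x + e μ) :=
  ⟨fun _ => ⟨min_le_left _ _, le_max_left _ _⟩, fun i => ⟨min_le_right _ _, (le_add_e x μ i).trans (le_max_right _ _)⟩,
    fun i => ⟨(min_le_right _ _).trans (le_add_e x μ i), le_max_right _ _⟩⟩

end Box

section Sizes

variable {S : Scales L} {G : Type} [GaugeGroup G] [MeasurableSpace G] [HaarData G] (𝔊 : GroupModel G) (𝔠 : AlphaConsts L 𝔊.N)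
  (X : ExternalInputs S G)

/-- **PRINT'S LOCALIZED INDEX SET «Y_j ⊂ Ω_k» FOR ONE BOND at the passage `k → k+1`** (history `h ∈ Hist (k+1)`, old scale `j`, block `y`, bond
`c`): the history is admissible (it carries the expansion; inadmissible tuples have mass `0`), `|c₋ − y| < R(g_j)M₁L^jη` ((43): `Site.tdist c₋ y <
Rcol j`), and every fine site under the scale-`j` box spanned by `y`, `c₋`, `c₊` (read on the nearest-representative lift) lies in `Ω_k(h)` —
the region the loop variable `B(c)` depends on is inside the small-field region, as print keeps only terms with localizations inside the current
region (p. 272 L29–31). [cite: Balaban1985UV3, (43) p.266 + p.272 L29–31] -/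
def LocIn (k : ℕ) (h : Hist S.P (k + 1)) (j : ℕ) (y : Site S.P j) (c : PBond S.P j) : Prop :=
  Hist.Admissible 𝔠.lane.carrier.M₁ (rcolOf S 𝔠.lane.carrier) (k + 1) h ∧
    Site.tdist c.src y < rcolOf S 𝔠.lane.carrier j ∧
      ∀ z : B7Prop1Explicit.Site S.P.d,
        InBox (loK L j (boxLo (repZ y) (nearRepZ y c.src)))
            (fun i => (L : ℤ) ^ j * boxHi (repZ y) (nearRepZ y c.src) c.dir i + ((L : ℤ) ^ j - 1)) z →
          projSite z ∈ Omega 𝔠.lane.carrier.M₁ (rcolOf S 𝔠.lane.carrier) (k + 1) h k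

omit [HaarData G] in
/-- **NON-VACUITY OF THE LOCALIZATION**: at the trivial history (no large fields: `Ω_k = T_η`, p. 272 L32–33) the localized index set is
the whole admissible radius — every bond `c` with `|c₋ − y| < R(g_j)M₁L^jη` carries the genuine loop size. [cite: Balaban1985UV3, (43) p.266 + p.272 L32–33] -/
theorem locIn_triv_iff (k j : ℕ) (y : Site S.P j) (c : PBond S.P j) :
    LocIn 𝔊 𝔠 (S := S) k (Hist.triv S.P (k + 1)) j y c ↔ Site.tdist c.src y < rcolOf S 𝔠.lane.carrier j := by
  unfold LocIn
  simp only [Omega_triv, Set.mem_univ, implies_true, and_true]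
  exact and_iff_right (Hist.admissible_triv _ _ (k + 1))

open Classical in
/-- **THE CONCRETE LOOP SIZES `|B_{k+1}(c)|` OF (43)** at the passage `k → k+1`: on the localized index set `LocIn`, the norm of the (27)-loop
variable `B(c) = (1∕i) log Ū^j(Γ_{y,c₋} ∪ c ∪ Γ_{c₊,y})` (`B10Eq27AxialLog.B27`) of the `j`-fold average ([4] (43), `B7Prop2Explicit.avgIter`) of
the lifted composite minimizer `liftCfg 𝔊 (U_{k+1}(h, U))`, read from `repZ y` to the nearest representative of `c₋`; `0` off it (no term there).
[cite: Balaban1985UV3, (43) p.266 + (27) p.263] -/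
def loopOf (k : ℕ) (h : Hist S.P (k + 1)) (U : GaugeField S.P (k + 1) G) (j : ℕ) (y : Site S.P j) (c : PBond S.P j) : ℝ :=
  if LocIn 𝔊 𝔠 (S := S) k h j y c then
    ‖B27 (avgIter L (liftCfg 𝔊 (X.UkH (k + 1) h U)) j) (repZ y) (nearRepZ y c.src) c.dir‖
  else 0

/-- The loop sizes are sizes. [folklore] -/
theorem loopOf_nonneg (k : ℕ) (h : Hist S.P (k + 1)) (U : GaugeField S.P (k + 1) G) (j : ℕ) (y : Site S.P j) (c : PBond S.P j) :
    0 ≤ loopOf 𝔊 𝔠 X k h U j y c := by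
  unfold loopOf; split_ifs; exacts [norm_nonneg _, le_rfl]

/-- On the localized index set the size IS `‖B(c)‖` of the averaged lifted minimizer. [cite: Balaban1985UV3, (43) p.266] -/
theorem loopOf_eq_of_locIn {k : ℕ} {h : Hist S.P (k + 1)} (U : GaugeField S.P (k + 1) G) {j : ℕ} {y : Site S.P j} {c : PBond S.P j}
    (hloc : LocIn 𝔊 𝔠 (S := S) k h j y c) :
    loopOf 𝔊 𝔠 X k h U j y c = ‖B27 (avgIter L (liftCfg 𝔊 (X.UkH (k + 1) h U)) j) (repZ y) (nearRepZ y c.src) c.dir‖ := by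
  classical
  unfold loopOf; rw [if_pos hloc]

/-- Off the localized index set there is no term: the size is `0`. [cite: Balaban1985UV3, p.272 L29–31] -/
theorem loopOf_eq_zero_of_not_locIn {k : ℕ} {h : Hist S.P (k + 1)} (U : GaugeField S.P (k + 1) G) {j : ℕ} {y : Site S.P j} {c : PBond S.P j}
    (hloc : ¬ LocIn 𝔊 𝔠 (S := S) k h j y c) : loopOf 𝔊 𝔠 X k h U j y c = 0 := by
  classical
  unfold loopOf; rw [if_neg hloc]

/-- **THE SIZES (43) IS WRITTEN IN, HALF CONCRETE**: coefficient sizes `|𝒫_j(Y_j)|` FREE (`coef`, the cluster expansion's output — class II), loop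
sizes CONCRETE (`loopOf`). [cite: Balaban1985UV3, (43) p.266] -/
def sizesOf (coef : (k : ℕ) → Hist S.P (k + 1) → GaugeField S.P (k + 1) G → (j : ℕ) → TermSizes (oldGeom S.P k j)) : OldTermSizes S G :=
  ⟨coef, fun k h U j y c => loopOf 𝔊 𝔠 X k h U j y c⟩

/-! ## §3 (44)'s loop input DERIVED from the scale-`k` plaquette clause of [7] (2)∕(8) -/

/-- **THE DISPLAYED SMALLNESS «for g_{k−1} sufficiently small»** (p. 267 L7–8) for `α₀ = C68·g_kp(g_k)` (the constant of the face `reg2` at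
scale `k`): [4] Prop. 2's `C₀α₀ ≤ ⅓`, `2α₀ ≤ c₂′(3, L)` ((52)–(54)), and for the logarithm (28) the bond restriction `R(g_j)M₁ · 2α₀(L^jη)² ≤ ½` on
the admissible radius of (43).  Conditions on the coupling window and the constants; HYPOTHESES. [cite: Balaban1985UV3, p.267 L7–8 + (43) p.266] -/
structure LoopSmall : Prop where
  /-- [4] Prop. 2: `C₀α₀ ≤ ⅓` -/
  hα3 : ∀ k, k + 1 ≤ S.K → C0 S.P.d * (𝔠.C68 * (S.gk k * pFun 𝔠.b₀ 𝔠.p₀ (S.gk k))) ≤ 1 / 3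
  /-- [4] Prop. 2: `2α₀ ≤ c₂′` -/
  hα2 : ∀ k, k + 1 ≤ S.K → 2 * (𝔠.C68 * (S.gk k * pFun 𝔠.b₀ 𝔠.p₀ (S.gk k))) ≤ c2' S.P.d L
  /-- (28): `|c₋ − y|₁ · 2α₀(L^jη)² ≤ ½` on the admissible radius `Rcol j` -/
  hrad : ∀ k, k + 1 ≤ S.K → ∀ j ∈ Finset.Icc 1 k,
    (rcolOf S 𝔠.lane.carrier j : ℝ) * (2 * (𝔠.C68 * (S.gk k * pFun 𝔠.b₀ 𝔠.p₀ (S.gk k))) * ell S.P k j ^ 2) ≤ 1 / 2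

/-- `L^j·(L^k)⁻¹ = ℓ_j = L^{−(k−j)}` for `j ≤ k` (the `L^jη`-spacing in the units of `T^{(k)}`, `Carriers.ell`). [folklore] -/
theorem scale_eq_ell {j k : ℕ} (hjk : j ≤ k) : (L : ℝ) ^ j * ((L : ℝ) ^ k)⁻¹ = ell S.P k j := by
  obtain ⟨m, rfl⟩ := Nat.exists_eq_add_of_le hjk
  have hL : (L : ℝ) ≠ 0 := by exact_mod_cast (ne_of_gt (lt_trans zero_lt_one S.hL.2))
  show (L : ℝ) ^ j * ((L : ℝ) ^ (j + m))⁻¹ = ((L : ℝ)⁻¹) ^ (j + m - j)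
  rw [Nat.add_sub_cancel_left, pow_add, mul_inv, ← mul_assoc, mul_inv_cancel₀ (pow_ne_zero j hL), one_mul, inv_pow]

/-- **(44)'s LOOP INPUT — gen 0's face `loop28` — HOLDS FOR THE CONCRETE SIZES, from the face `reg2`** ([7] (2)∕(8): the scale-`k` clause
«|U_{k+1}(∂p) − 1| < C68 g_kp(g_k)L^{−2k}» of the lifted `U_{k+1}(h, ·)` over `Ω_k(h)` — print's «The configuration U_k satisfies the following
regularity condition on Ω_k … This implies |Ū_k^j(∂p′) − 1| < 4L²B₃g_{k−1}p(g_{k−1})(L^jη)² for p′ ⊂ Ω_k^{(j)}», p. 267 L1–3, in the lane's step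
indexing): `|B_{k+1}(c)| ≤ (L^jη)^{−1}|c₋ − y| · 8L²B₃g_kp(g_k)(L^jη)²` for every `k < K`, history, field, `1 ≤ j ≤ k`, `y`, `c`.  On `LocIn` the
fine box under the contour's box lies in `Ω_k(h)`, so the clause bounds every unit plaquette there and the LOCAL ladder
`B10Eq44LoopLocal.loop44_le_local_unitaryGroup` ([4] Prop. 2 at every level + (28)) gives `‖B(c)‖ ≤ |c₋ − y|₁ · 4C68 g_kp(g_k)(L^jη)²`, `|c₋ − y|₁ =
tdist c₋ y` (`l1_nearRepZ_sub_repZ`), `4C68 ≤ 8L²B₃`; off `LocIn` the size is `0`.  Smallness: `LoopSmall`. [cite: Balaban1985UV3, (44) p.267] -/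
theorem loop28_of_reg2 (coef : (k : ℕ) → Hist S.P (k + 1) → GaugeField S.P (k + 1) G → (j : ℕ) → TermSizes (oldGeom S.P k j))
    (hreg2 : ∀ k, k ≤ S.K → ∀ (h : Hist S.P k), Hist.Admissible 𝔠.lane.carrier.M₁ (rcolOf S 𝔠.lane.carrier) k h →
      ∀ (U : GaugeField S.P k G), ∀ j < k,
        RegLift S j (Omega 𝔠.lane.carrier.M₁ (rcolOf S 𝔠.lane.carrier) k h j)
          (𝔠.C68 * (S.gk j * pFun 𝔠.lane.carrier.b₀ 𝔠.lane.carrier.p₀ (S.gk j))) (liftCfg 𝔊 (X.UkH k h U)))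
    (hsm : LoopSmall 𝔊 𝔠 (S := S)) (hC68 : 𝔠.C68 ≤ 2 * (L : ℝ) ^ 2 * 𝔠.B₃) :
    ∀ k, k + 1 ≤ S.K → ∀ (h : Hist S.P (k + 1)) (U : GaugeField S.P (k + 1) G), ∀ j ∈ Finset.Icc 1 k,
      ∀ (y : (oldGeom S.P k j).Site) (b : (oldGeom S.P k j).Bond),
        (sizesOf 𝔊 𝔠 X coef).loop k h U j y b ≤ ((ell S.P k j)⁻¹ * (oldGeom S.P k j).dist ((oldGeom S.P k j).cminus b) y) *
          (8 * (L : ℝ) ^ 2 * 𝔠.B₃ * S.gk k * pFun 𝔠.b₀ 𝔠.p₀ (S.gk k) * ell S.P k j ^ 2) := by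
  intro k hk h U j hj y b
  haveI : NeZero 𝔊.N := ⟨Nat.pos_iff_ne_zero.mp 𝔊.N_pos⟩
  obtain ⟨hj1, hjk⟩ := Finset.mem_Icc.1 hj
  rw [ell_inv_mul_dist]
  show loopOf 𝔊 𝔠 X k h U j y b ≤ _
  -- the constants
  have hL2 : 2 ≤ L := by have := S.hL.2; omega
  have hLr : (0 : ℝ) < L := by exact_mod_cast lt_of_lt_of_le (by norm_num) hL2
  have hgk : 0 < S.gk k := gk_pos S k
  have hpg : 0 < pFun 𝔠.b₀ 𝔠.p₀ (S.gk k) := pFun_pos _ _ _ 𝔠.b₀_pos hgk (gk_le_one S S.gK_le_one k (by omega))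
  set gp := S.gk k * pFun 𝔠.b₀ 𝔠.p₀ (S.gk k) with hgp_def
  have hgp : 0 < gp := mul_pos hgk hpg
  have hell : 0 < ell S.P k j := ell_pos S.P k j
  have hrhs : 0 ≤ (Site.tdist b.src y : ℝ) * (8 * (L : ℝ) ^ 2 * 𝔠.B₃ * S.gk k * pFun 𝔠.b₀ 𝔠.p₀ (S.gk k) * ell S.P k j ^ 2) := by
    have := 𝔠.B₃_pos
    positivity
  by_cases hloc : LocIn 𝔊 𝔠 (S := S) k h j y b
  swap
  · rw [loopOf_eq_zero_of_not_locIn 𝔊 𝔠 X U hloc]; exact hrhs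
  rw [loopOf_eq_of_locIn 𝔊 𝔠 X U hloc]
  obtain ⟨hadm, hrad, hbox⟩ := hloc
  set W := liftCfg 𝔊 (X.UkH (k + 1) h U) with hW_def
  have hW : ∀ x κ, W x κ ∈ unitaryUnits (Matrix (Fin 𝔊.N) (Fin 𝔊.N) ℂ) := liftCfg_mem_unitaryUnits 𝔊 _
  -- the face `reg2` at level k+1, scale k: the clause over Ω_k(h)
  have hclause := hreg2 (k + 1) hk h hadm U k (lt_add_one k)
  have hb₀ : pFun 𝔠.lane.carrier.b₀ 𝔠.lane.carrier.p₀ (S.gk k) = pFun 𝔠.b₀ 𝔠.p₀ (S.gk k) := rfl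
  rw [hb₀] at hclause
  -- the letters of `loop44_le_local`: B₃′ := C68 / (2L²), ε := g_k p(g_k), so that 2L²B₃′ε = C68·g_kp(g_k)
  have hL2r : (L : ℝ) ^ 2 ≠ 0 := pow_ne_zero 2 hLr.ne'
  have h2 : 2 * (L : ℝ) ^ 2 * (𝔠.C68 / (2 * (L : ℝ) ^ 2)) * gp = 𝔠.C68 * gp := by field_simp
  have h4 : 4 * (L : ℝ) ^ 2 * (𝔠.C68 / (2 * (L : ℝ) ^ 2)) * gp = 2 * (𝔠.C68 * gp) := by field_simp; ring
  have h8 : 8 * (L : ℝ) ^ 2 * (𝔠.C68 / (2 * (L : ℝ) ^ 2)) * gp = 4 * (𝔠.C68 * gp) := by field_simp; ring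
  have hpos : 0 < (L : ℝ) ^ 2 * (𝔠.C68 / (2 * (L : ℝ) ^ 2)) * gp := by
    have : (L : ℝ) ^ 2 * (𝔠.C68 / (2 * (L : ℝ) ^ 2)) * gp = 𝔠.C68 * gp / 2 := by field_simp
    rw [this]; exact div_pos (mul_pos 𝔠.C68_pos hgp) two_pos
  have hα3 : C0 S.P.d * (2 * (L : ℝ) ^ 2 * (𝔠.C68 / (2 * (L : ℝ) ^ 2)) * gp) ≤ 1 / 3 := by rw [h2]; exact hsm.hα3 k hk
  have hα2 : 2 * (2 * (L : ℝ) ^ 2 * (𝔠.C68 / (2 * (L : ℝ) ^ 2)) * gp) ≤ c2' S.P.d L := by rw [h2]; exact hsm.hα2 k hk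
  -- regularity on the fine box under the contour's box, plaquette by plaquette, from the clause
  have hreg : ∀ (z : B7Prop1Explicit.Site S.P.d) (κ κ' : Fin S.P.d),
      InBox (loK L j (boxLo (repZ y) (nearRepZ y b.src)))
          (fun i => (L : ℤ) ^ j * boxHi (repZ y) (nearRepZ y b.src) b.dir i + ((L : ℤ) ^ j - 1)) z →
        InBox (loK L j (boxLo (repZ y) (nearRepZ y b.src)))
          (fun i => (L : ℤ) ^ j * boxHi (repZ y) (nearRepZ y b.src) b.dir i + ((L : ℤ) ^ j - 1)) (z + e κ + e κ') →
          ‖((hol W z (plaqWord κ κ') : (Matrix (Fin 𝔊.N) (Fin 𝔊.N) ℂ)ˣ) : Matrix (Fin 𝔊.N) (Fin 𝔊.N) ℂ) - 1‖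
            < 2 * (L : ℝ) ^ 2 * (𝔠.C68 / (2 * (L : ℝ) ^ 2)) * gp * (((L : ℝ) ^ k)⁻¹) ^ 2 := by
    intro z κ κ' hz _
    rw [h2]
    rcases eq_or_ne κ κ' with rfl | hne
    · rw [hol_plaqWord_self, Units.val_one, sub_self, norm_zero]
      exact mul_pos (mul_pos 𝔠.C68_pos hgp) (pow_pos (inv_pos.mpr (pow_pos hLr k)) 2)
    · exact hclause z κ κ' hne (Or.inl (hbox z hz))
  -- the smallness of the logarithm: |c₋ − y|₁ · 2C68 g p(g) ℓ² ≤ ½ on the admissible radius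
  have hsmall : (l1 (nearRepZ y b.src - repZ y) : ℝ) *
      (4 * (L : ℝ) ^ 2 * (𝔠.C68 / (2 * (L : ℝ) ^ 2)) * gp * ((L : ℝ) ^ j * ((L : ℝ) ^ k)⁻¹) ^ 2) ≤ 1 / 2 := by
    rw [h4, scale_eq_ell (S := S) hjk, l1_nearRepZ_sub_repZ]
    have hle : (Site.tdist b.src y : ℝ) ≤ rcolOf S 𝔠.lane.carrier j := by exact_mod_cast hrad.le
    have hfac : 0 ≤ 2 * (𝔠.C68 * gp) * ell S.P k j ^ 2 := by have := 𝔠.C68_pos; positivity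
    exact (mul_le_mul_of_nonneg_right hle hfac).trans (hsm.hrad k hk j hj)
  -- the local ladder
  have key := loop44_le_local_unitaryGroup 𝔊.N L hL2 k W hW hpos hα3 hα2 hjk (repZ y) (nearRepZ y b.src) b.dir
    (inBox_box _ _ _).1 (inBox_box _ _ _).2.1 (inBox_box _ _ _).2.2 hreg hsmall
  rw [h8, scale_eq_ell (S := S) hjk, l1_nearRepZ_sub_repZ] at key
  refine key.trans ?_
  have htd : 0 ≤ (Site.tdist b.src y : ℝ) := Nat.cast_nonneg _
  refine mul_le_mul_of_nonneg_left ?_ htd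
  -- 4C68·g p(g)·ℓ² ≤ 8L²B₃·g·p(g)·ℓ²
  have hgpℓ : 0 ≤ gp * ell S.P k j ^ 2 := by positivity
  calc 4 * (𝔠.C68 * gp) * ell S.P k j ^ 2 = (4 * 𝔠.C68) * (gp * ell S.P k j ^ 2) := by ring
    _ ≤ (8 * (L : ℝ) ^ 2 * 𝔠.B₃) * (gp * ell S.P k j ^ 2) := mul_le_mul_of_nonneg_right (by linarith) hgpℓ
    _ = 8 * (L : ℝ) ^ 2 * 𝔠.B₃ * S.gk k * pFun 𝔠.b₀ 𝔠.p₀ (S.gk k) * ell S.P k j ^ 2 := by rw [hgp_def]; ring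

/-! ## §4 The in-edge faces WITHOUT `loop28`, and the (α) clause ∕ N08 over them -/

/-- **THE THREE IN-EDGE FACES** — gen 0's `InEdgeFaces` with the row `loop28` REMOVED (it is a theorem for the concrete sizes, `loop28_of_reg2`):
`measUk` ([7] Thm 1 + Prop 9, census I*), `inB42` ([7] (3) = (42) at an `h`-large field history), `reg2` ([7] (2)∕(8): the scale-`j` plaquette
clauses of `U_k(h, ·)` over `Ω_j(h)`, `j < k`).  HYPOTHESES about the free object `X.UkH`; nothing asserted. [cite: Balaban1985Variational, (2)–(3) p.278 + Thm 1 (8) p.279] -/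
structure InEdgeFaces₃ : Prop where
  /-- [7] Thm 1 + Prop 9: `U_k(·, h)` is measurable (census I*) -/
  measUk : ∀ k, k + 1 ≤ S.K → ∀ h : Hist S.P k, Measurable (X.UkH k h)
  /-- [7] (3) = (42): `U_k(h, U)` lies in the constraint space of an `h`-large field history -/
  inB42 : ∀ k, k ≤ S.K → ∀ (h : Hist S.P k), Hist.Admissible 𝔠.lane.carrier.M₁ (rcolOf S 𝔠.lane.carrier) k h →
    ∀ (U : GaugeField S.P k G), ∃ V : ℕ → B7Prop1Explicit.Site S.P.d → Fin S.P.d → (Matrix (Fin 𝔊.N) (Fin 𝔊.N) ℂ)ˣ,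
      HLarge S 𝔠.lane.carrier.b₀ 𝔠.lane.carrier.p₀ h V ∧
        InB42Lift S 𝔠.lane.carrier.M₁ (rcolOf S 𝔠.lane.carrier) h (liftCfg 𝔊 (X.UkH k h U)) V
  /-- [7] (2)∕(8): `U_k(h, U)` satisfies the scale-`j` plaquette clauses over `Ω_j(h)` at the constant `C68·g_jp(g_j)` -/
  reg2 : ∀ k, k ≤ S.K → ∀ (h : Hist S.P k), Hist.Admissible 𝔠.lane.carrier.M₁ (rcolOf S 𝔠.lane.carrier) k h →
    ∀ (U : GaugeField S.P k G), ∀ j < k,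
      RegLift S j (Omega 𝔠.lane.carrier.M₁ (rcolOf S 𝔠.lane.carrier) k h j)
        (𝔠.C68 * (S.gk j * pFun 𝔠.lane.carrier.b₀ 𝔠.lane.carrier.p₀ (S.gk j))) (liftCfg 𝔊 (X.UkH k h U))

/-- **THE FOUR FACES OF GEN 0 AT THE CONCRETE SIZES, FROM THE THREE** (under the displayed smallness and `C68 ≤ 2L²B₃`): `loop28` by
`loop28_of_reg2`. [cite: Balaban1985UV3, (44) p.267] -/
theorem inEdgeFaces_of_three (coef : (k : ℕ) → Hist S.P (k + 1) → GaugeField S.P (k + 1) G → (j : ℕ) → TermSizes (oldGeom S.P k j))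
    (F : InEdgeFaces₃ 𝔊 𝔠 X) (hsm : LoopSmall 𝔊 𝔠 (S := S)) (hC68 : 𝔠.C68 ≤ 2 * (L : ℝ) ^ 2 * 𝔠.B₃) :
    InEdgeFaces 𝔊 𝔠 X (sizesOf 𝔊 𝔠 X coef) where
  measUk := F.measUk
  loop28 := loop28_of_reg2 𝔊 𝔠 X coef F.reg2 hsm hC68
  inB42 := F.inB42
  reg2 := F.reg2

variable (𝔖 : ∀ k, StepSeries S G ↥(lieC 𝔊) (nblkOf S 𝔠.lane.carrier k) k) (𝔄 : AlphaData 𝔊 𝔠 X 𝔖)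

/-- **THE (α) CLAUSE FROM «DATA ∧ (43)-FORM AT THE CONCRETE SIZES ∧ THREE FACES»** (+ smallness, `C68 ≤ 2L²B₃`): `RunAlpha 𝔊 𝔠 X 𝔖 𝔄` — gen 0's
`runAlpha_of_data_faces` with its face `loop28` now a theorem.  What remains DISPLAYED of the lane's (α) clause: the cluster-expansion data
(classes II + III), (43)'s form for the data's old terms written in the concrete loop variables on print's localized index set, the in-edge
sentences [7] (2)∕(3) + measurability about `X.UkH`, and «g sufficiently small». [cite: Balaban1985UV3, (41) p.266 + (44) p.267 + (47) p.267] -/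
theorem runAlpha_of_data_faces₃
    (coef : (k : ℕ) → Hist S.P (k + 1) → GaugeField S.P (k + 1) G → (j : ℕ) → TermSizes (oldGeom S.P k j))
    (D : RunDataRows 𝔊 𝔠 X 𝔖 𝔄 (sizesOf 𝔊 𝔠 X coef)) (F : InEdgeFaces₃ 𝔊 𝔠 X) (hsm : LoopSmall 𝔊 𝔠 (S := S))
    (hC68 : 𝔠.C68 ≤ 2 * (L : ℝ) ^ 2 * 𝔠.B₃) : RunAlpha 𝔊 𝔠 X 𝔖 𝔄 :=
  runAlpha_of_data_faces D (inEdgeFaces_of_three 𝔊 𝔠 X coef F hsm hC68)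

end Sizes

/-! ## §5 N08 at the C-binding of record over the constructed family from «DATA ∧ three faces» (through gen 0's §5 by name) -/

section N08

variable {G : Type} [GaugeGroup G] [MeasurableSpace G] [HaarData G] {𝔊 : GroupModel G} {𝔠 : AlphaConsts L 𝔊.N}
  {X : ∀ S : Scales L, ExternalInputs S G}
  {𝔖 : ∀ (S : Scales L) (k : ℕ), StepSeries S G ↥(lieC 𝔊) (nblkOf S 𝔠.lane.carrier k) k}
  {𝔄 : ∀ S : Scales L, AlphaData 𝔊 𝔠 (X S) (𝔖 S)}
  {coef : ∀ (S : Scales L) (k : ℕ), Hist S.P (k + 1) → GaugeField S.P (k + 1) G → (j : ℕ) → TermSizes (oldGeom S.P k j)}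
  {Xc : PrintedCarriersR} {Y : PrintedCarriers9X} {Z : PrintedCarriers11} {V : PrintedCarriers14R} {W : PrintedCarriers15}
  {w : WorldP} {P : B12.RunParams}

/-- **N08 BY NAME AT THE C-BINDING OF RECORD OVER THE CONSTRUCTED RUN FAMILY, from the DATA (at the concrete sizes) and the THREE faces** on the
`≤`-family `S.g²·S.ε₀ ≤ (min γ₀ 1)²`, under the displayed smallness per approximation and `C68 ≤ 2L²B₃`: `Dag.B10_main (leavesP w P)` at `w.up P =
ofPrintedAllXPNC (Xc.withTowerRuns10 (S ↦ towerOf 𝔠.lane (X S) (𝔖 S))) Y Z V W` (gen 0's `b10_main_constructedLE_upC_of_faces` ∘ `inEdgeFaces_of_three`).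
[cite: Balaban1985UV3, Thm 1 p.257 (compact reading) + Thm 2 p.272] -/
theorem b10_main_constructedLE_upC_of_faces₃
    (hD : ∀ S : Scales L, S.g ^ 2 * S.ε₀ ≤ (min 𝔠.gamma0 1) ^ 2 → RunDataRows 𝔊 𝔠 (X S) (𝔖 S) (𝔄 S) (sizesOf 𝔊 𝔠 (X S) (coef S)))
    (hF : ∀ S : Scales L, S.g ^ 2 * S.ε₀ ≤ (min 𝔠.gamma0 1) ^ 2 → InEdgeFaces₃ 𝔊 𝔠 (X S))
    (hsm : ∀ S : Scales L, S.g ^ 2 * S.ε₀ ≤ (min 𝔠.gamma0 1) ^ 2 → LoopSmall 𝔊 𝔠 (S := S))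
    (hC68 : 𝔠.C68 ≤ 2 * (L : ℝ) ^ 2 * 𝔠.B₃)
    (hup : w.up P = ofPrintedAllXPNC (Xc.withTowerRuns10 fun S : ScalesLE L ((min 𝔠.gamma0 1) ^ 2) =>
      towerOf 𝔠.lane (X S.1) (𝔖 S.1)) Y Z V W) :
    Dag.B10_main (leavesP w P) :=
  b10_main_constructedLE_upC_of_faces (𝔏 := fun S => sizesOf 𝔊 𝔠 (X S) (coef S)) hD
    (fun S hS => inEdgeFaces_of_three 𝔊 𝔠 (X S) (coef S) (hF S hS) (hsm S hS) hC68) hup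

end N08

end Summit.QuantumFields.YangMills.Theorems.BalabanUVNodesN08AlphaLoop28

end
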